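import Mathlib.Analysis.Calculus.ContDiff.Bounds
import Mathlib.Analysis.Calculus.IteratedDeriv.Lemmas
import Mathlib.Analysis.SpecialFunctions.ExpDeriv
import Mathlib.MeasureTheory.Integral.IntegralEqImproper
import Mathlib.Analysis.Calculus.BumpFunction.Basic
import HarnessLib

/-!
# Iterated non-stationary phase on the line

The standard "first-derivative test with smooth amplitude", iterated: for a smooth compactly
supported amplitude `g` and a real phase `ψ` whose derivative `Ψ₁ = ψ'` does not vanish,
`∫ g(t) e^{2πiψ(t)} dt = (−1/2πi)^p ∫ (L^p g)(t) e^{2πiψ(t)} dt`, `L h = (h/ψ')'`, and with the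
scaled bounds `|g^{(j)}| ≤ A L^{-j}`, `|(1/ψ')^{(j)}| ≤ C_r λ^{-1} L^{-j}` (`j ≤ p`) one gets

  `|∫ g e^{2πiψ}| ≤ (β − α) A (2^p C_r/(2π λ L))^p`      (`supp g ⊆ [α, β]`),

i.e. the integral is `≪_p A (β − α) (λL)^{-p}` — each integration by parts gains a factor
`(λ L)^{-1}`, the product of the size `λ` of `ψ'` and the scale `L` of the amplitude
(folklore; e.g. Stein, *Harmonic Analysis*, Ch. VIII §1.2 Prop. 1 & Cor.; Iwaniec–Kowalski
Lemma 8.9 / (8.19)).  We also prove the bounds for the derivatives of a reciprocal `1/f` from bounds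
on the derivatives of `f` and `|f| ≥ λ` that turn hypotheses on `ψ''`, `ψ'''`, … into the hypothesis
on `1/ψ'` (`exists_norm_iteratedDeriv_inv_le`).

Everything is PROVED; the only definitions are the oscillating factor `phaseExp` and the operator `ibpStep`.

Main results (namespace `Literature.Analysis.Asymptotics`):

* `norm_iteratedDeriv_mul_le` — the Leibniz bound in `iteratedDeriv` form (from Mathlib's
  `norm_iteratedFDeriv_mul_le`); `norm_iteratedDeriv_mul_le_of_scaled` — with scaled jet bounds
  `A L^{-i}`, `B L^{-i}` the product has `2^n A B L^{-n}`;
* `exists_norm_iteratedDeriv_inv_le` — reciprocal bounds;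
* `integral_mul_phaseExp_eq_ibpStep` — one integration by parts; `integral_mul_phaseExp_eq_iterate` —
  `p` of them; `norm_iteratedDeriv_iterate_ibpStep_le` — the jet bounds along the iteration;
* `norm_integral_mul_phaseExp_le` — the displayed bound (`phaseExp ψ t = exp(2πi ψ(t))`).

## References
* E. M. Stein, *Harmonic Analysis* (1993), Ch. VIII §1.2; H. Iwaniec, E. Kowalski, *Analytic Number
  Theory* (2004), Lemma 8.9. (Folklore integration by parts; tagged `[folklore]`.)
-/

noncomputable section

open Set MeasureTheory Filter Finset
open scoped ContDiff Topology

namespace Literature.Analysis.Asymptotics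

/-! ### Leibniz bounds in `iteratedDeriv` form -/

/-- **Leibniz bound** for `ℝ → ℂ` functions: `‖(fg)^{(n)}(x)‖ ≤ ∑_i C(n,i) ‖f^{(i)}(x)‖ ‖g^{(n-i)}(x)‖`
(Mathlib's `norm_iteratedFDeriv_mul_le` rewritten with `iteratedDeriv`). [folklore] -/
theorem norm_iteratedDeriv_mul_le {f g : ℝ → ℂ} (hf : ContDiff ℝ ∞ f) (hg : ContDiff ℝ ∞ g)
    (x : ℝ) (n : ℕ) :
    ‖iteratedDeriv n (fun y => f y * g y) x‖ ≤
      ∑ i ∈ Finset.range (n + 1), (n.choose i : ℝ) * ‖iteratedDeriv i f x‖ * ‖iteratedDeriv (n - i) g x‖ := by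
  have h := norm_iteratedFDeriv_mul_le (N := ∞) hf hg x (n := n) (by exact_mod_cast le_top)
  simp only [norm_iteratedFDeriv_eq_norm_iteratedDeriv] at h
  exact h

/-- `∑_i C(n, i) = 2^n` in `ℝ`. [folklore] -/
private theorem sum_range_choose_real (n : ℕ) : ∑ i ∈ Finset.range (n + 1), (n.choose i : ℝ) = 2 ^ n := by
  have h := Nat.sum_range_choose n
  exact_mod_cast h

/-- **Leibniz with scaled jet bounds**: if `‖f^{(i)}(x)‖ ≤ A/L^i` and `‖g^{(i)}(x)‖ ≤ B/L^i` for
`i ≤ n`, then `‖(fg)^{(n)}(x)‖ ≤ 2^n A B / L^n` (`L > 0`, `A, B ≥ 0`). [folklore] -/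
theorem norm_iteratedDeriv_mul_le_of_scaled {f g : ℝ → ℂ} (hf : ContDiff ℝ ∞ f) (hg : ContDiff ℝ ∞ g)
    (x : ℝ) (n : ℕ) {A B L : ℝ} (hA : 0 ≤ A) (hL : 0 < L)
    (hfA : ∀ i ≤ n, ‖iteratedDeriv i f x‖ ≤ A / L ^ i) (hgB : ∀ i ≤ n, ‖iteratedDeriv i g x‖ ≤ B / L ^ i) :
    ‖iteratedDeriv n (fun y => f y * g y) x‖ ≤ 2 ^ n * A * B / L ^ n := by
  refine (norm_iteratedDeriv_mul_le hf hg x n).trans ?_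
  have hterm : ∀ i ∈ Finset.range (n + 1),
      (n.choose i : ℝ) * ‖iteratedDeriv i f x‖ * ‖iteratedDeriv (n - i) g x‖ ≤
        (n.choose i : ℝ) * (A * B / L ^ n) := by
    intro i hi
    rw [Finset.mem_range, Nat.lt_succ_iff] at hi
    have h1 := hfA i hi
    have h2 := hgB (n - i) (Nat.sub_le _ _)
    have hpow : L ^ i * L ^ (n - i) = L ^ n := by rw [← pow_add, Nat.add_sub_cancel' hi]
    rw [mul_assoc]
    refine mul_le_mul_of_nonneg_left ?_ (Nat.cast_nonneg _)
    calc ‖iteratedDeriv i f x‖ * ‖iteratedDeriv (n - i) g x‖ ≤ (A / L ^ i) * (B / L ^ (n - i)) :=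
          mul_le_mul h1 h2 (norm_nonneg _) (by positivity)
      _ = A * B / L ^ n := by rw [div_mul_div_comm, hpow]
  refine (Finset.sum_le_sum hterm).trans (le_of_eq ?_)
  rw [← Finset.sum_mul, sum_range_choose_real]
  ring

/-! ### Derivatives of a reciprocal -/

/-- On the set where `f` is smooth and nonvanishing, `(f⁻¹)' = −f' (f⁻¹)²`; for a globally smooth
nonvanishing `f` this reads `deriv f⁻¹ = fun t => −deriv f t * (f t)⁻¹ * (f t)⁻¹`. [folklore] -/
theorem deriv_inv_eq {f : ℝ → ℂ} (hf : ContDiff ℝ ∞ f) (h0 : ∀ t, f t ≠ 0) :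
    deriv (fun s => (f s)⁻¹) = fun t => -(deriv f t) * ((f t)⁻¹ * (f t)⁻¹) := by
  funext t
  have hd : HasDerivAt f (deriv f t) t := (hf.differentiable (by simp) t).hasDerivAt
  rw [(hd.fun_inv (h0 t)).deriv]
  field_simp

/-- **Bounds for the derivatives of a reciprocal.**  For every `p` and `Q ≥ 0` there is `C ≥ 0`
(depending on `p, Q` only) such that: if `f : ℝ → ℂ` is smooth, `‖f‖ ≥ λ > 0` everywhere and
`‖f^{(j)}‖ ≤ Q λ / L^j` for `1 ≤ j ≤ p` (`L > 0`), then `‖(1/f)^{(j)}‖ ≤ C/(λ L^j)` for `j ≤ p`.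
Proof: induction on `p` through `(1/f)' = −f' (1/f)²` and the Leibniz bound. [folklore] -/
theorem exists_norm_iteratedDeriv_inv_le (p : ℕ) {Q : ℝ} (hQ : 0 ≤ Q) :
    ∃ C : ℝ, 0 ≤ C ∧ ∀ (f : ℝ → ℂ) (lam L : ℝ), 0 < lam → 0 < L → ContDiff ℝ ∞ f →
      (∀ t, lam ≤ ‖f t‖) → (∀ j, 1 ≤ j → j ≤ p → ∀ t, ‖iteratedDeriv j f t‖ ≤ Q * lam / L ^ j) →
      ∀ j ≤ p, ∀ t, ‖iteratedDeriv j (fun s => (f s)⁻¹) t‖ ≤ C / (lam * L ^ j) := by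
  induction p with
  | zero =>
    refine ⟨1, zero_le_one, fun f lam L hlam hL hf hlow hder j hj t => ?_⟩
    have hj0 : j = 0 := Nat.le_zero.1 hj
    subst hj0
    rw [iteratedDeriv_zero, pow_zero, mul_one, norm_inv]
    rw [one_div]
    exact inv_anti₀ hlam (hlow t)
  | succ p ih =>
    obtain ⟨C, hC0, hC⟩ := ih
    -- the new constant
    refine ⟨max C (2 ^ p * Q * (2 ^ p * C * C)), le_max_of_le_left hC0, ?_⟩
    intro f lam L hlam hL hf hlow hder j hj t
    have h0 : ∀ t, f t ≠ 0 := fun t h => by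
      have := hlow t; rw [h, norm_zero] at this; linarith
    -- the bounds up to order `p` from the induction hypothesis
    have hp : ∀ j ≤ p, ∀ t, ‖iteratedDeriv j (fun s => (f s)⁻¹) t‖ ≤ C / (lam * L ^ j) :=
      hC f lam L hlam hL hf hlow (fun j hj1 hjp t => hder j hj1 (hjp.trans (Nat.le_succ p)) t)
    rcases Nat.of_le_succ hj with hjp | hjp
    · exact (hp j hjp t).trans (div_le_div_of_nonneg_right (le_max_left _ _) (by positivity))
    · subst hjp
      -- `(f⁻¹)^{(p+1)} = (−f' f⁻¹ f⁻¹)^{(p)}`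
      have hinv : ContDiff ℝ ∞ (fun s => (f s)⁻¹) := hf.inv h0
      rw [iteratedDeriv_succ', deriv_inv_eq hf h0]
      -- Leibniz twice
      have hsq : ∀ i ≤ p, ‖iteratedDeriv i (fun s => (f s)⁻¹ * (f s)⁻¹) t‖ ≤
          2 ^ i * (C / lam) * (C / lam) / L ^ i := by
        intro i hi
        refine norm_iteratedDeriv_mul_le_of_scaled hinv hinv t i (by positivity) hL
          (fun k hk => ?_) (fun k hk => ?_)
        · rw [div_div]; exact hp k (hk.trans hi) t
        · rw [div_div]; exact hp k (hk.trans hi) t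
      have hder' : ∀ i ≤ p, ‖iteratedDeriv i (fun s => -deriv f s) t‖ ≤ Q * lam / L * 1 / L ^ i := by
        intro i hi
        rw [iteratedDeriv_fun_neg, norm_neg, ← iteratedDeriv_succ']
        have := hder (i + 1) (Nat.succ_le_succ (Nat.zero_le _)) (Nat.succ_le_succ hi) t
        refine this.trans (le_of_eq ?_)
        rw [pow_succ]; field_simp
      have hneg : ContDiff ℝ ∞ (fun s => -deriv f s) := (hf.deriv').neg
      have hmain := norm_iteratedDeriv_mul_le_of_scaled hneg (hinv.mul hinv) t p
        (A := Q * lam / L * 1) (B := 2 ^ p * (C / lam) * (C / lam)) (by positivity) hL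
        hder' (fun i hi => (hsq i hi).trans (by
          refine div_le_div_of_nonneg_right ?_ (by positivity)
          have : (2 : ℝ) ^ i ≤ 2 ^ p := pow_le_pow_right₀ (by norm_num) hi
          have hc : 0 ≤ C / lam * (C / lam) := by positivity
          nlinarith))
      refine hmain.trans ?_
      rw [pow_succ]
      have hlam0 : lam ≠ 0 := hlam.ne'
      have hL0 : L ≠ 0 := hL.ne'
      rw [div_le_div_iff₀ (by positivity) (by positivity)]
      have e1 : 2 ^ p * (Q * lam / L * 1) * (2 ^ p * (C / lam) * (C / lam)) * (lam * (L ^ p * L)) =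
          (2 ^ p * Q * (2 ^ p * C * C)) * L ^ p := by field_simp
      rw [e1]
      exact mul_le_mul_of_nonneg_right (le_max_right _ _) (by positivity)

/-! ### One integration by parts against `e^{2πiψ}` -/

/-- The oscillating factor `E(t) = exp(2πi ψ(t))`. [folklore] -/
def phaseExp (ψ : ℝ → ℝ) (t : ℝ) : ℂ := Complex.exp (2 * Real.pi * Complex.I * ψ t)

/-- `|E(t)| = 1`. [folklore] -/
theorem norm_phaseExp (ψ : ℝ → ℝ) (t : ℝ) : ‖phaseExp ψ t‖ = 1 := by
  rw [phaseExp, Complex.norm_exp]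
  simp

/-- `E' = 2πi ψ' E`. [folklore] -/
theorem hasDerivAt_phaseExp {ψ Ψ₁ : ℝ → ℝ} (hψ : ∀ t, HasDerivAt ψ (Ψ₁ t) t) (t : ℝ) :
    HasDerivAt (phaseExp ψ) (2 * Real.pi * Complex.I * Ψ₁ t * phaseExp ψ t) t := by
  unfold phaseExp
  have h := ((hψ t).ofReal_comp.const_mul (2 * Real.pi * Complex.I)).cexp
  refine h.congr_deriv ?_
  ring

/-- `E` is continuous. [folklore] -/
theorem continuous_phaseExp {ψ Ψ₁ : ℝ → ℝ} (hψ : ∀ t, HasDerivAt ψ (Ψ₁ t) t) : Continuous (phaseExp ψ) :=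
  continuous_iff_continuousAt.2 fun t => (hasDerivAt_phaseExp hψ t).continuousAt

/-- **The integration-by-parts operator** `L_r h = (h r)'` (`r = 1/ψ'`). [folklore] -/
def ibpStep (r : ℝ → ℂ) (h : ℝ → ℂ) : ℝ → ℂ := deriv fun t => h t * r t

/-- `L_r` preserves smoothness. [folklore] -/
theorem contDiff_ibpStep {r h : ℝ → ℂ} (hr : ContDiff ℝ ∞ r) (hh : ContDiff ℝ ∞ h) :
    ContDiff ℝ ∞ (ibpStep r h) := (hh.mul hr).deriv'

/-- `L_r h` vanishes on any open set on which `h` vanishes. [folklore] -/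
theorem ibpStep_eq_zero_of_eqOn {r h : ℝ → ℂ} {U : Set ℝ} (hU : IsOpen U) (hh : EqOn h 0 U) :
    EqOn (ibpStep r h) 0 U := by
  intro t ht
  have hev : (fun s => h s * r s) =ᶠ[𝓝 t] fun _ => (0 : ℂ) := by
    filter_upwards [hU.mem_nhds ht] with s hs
    rw [hh hs]; simp
  rw [ibpStep, hev.deriv_eq, deriv_const]
  rfl

/-- **One integration by parts**: for `h` smooth, vanishing off `[α, β]`, `r` smooth with
`r ψ' = 1` and `ψ' = Ψ₁` continuous, `∫ h E = −(2πi)⁻¹ ∫ (L_r h) E` (`E = e^{2πiψ}`). [folklore] -/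
theorem integral_mul_phaseExp_eq_ibpStep {h r : ℝ → ℂ} {ψ Ψ₁ : ℝ → ℝ} {α β : ℝ}
    (hh : ContDiff ℝ ∞ h) (hhs : ∀ t ∉ Icc α β, h t = 0) (hr : ContDiff ℝ ∞ r)
    (hψ : ∀ t, HasDerivAt ψ (Ψ₁ t) t) (hΨ : Continuous Ψ₁) (hrΨ : ∀ t, r t * Ψ₁ t = 1) :
    ∫ t, h t * phaseExp ψ t = -(2 * Real.pi * Complex.I)⁻¹ * ∫ t, ibpStep r h t * phaseExp ψ t := by
  -- `u = h r`, `v = E`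
  set u : ℝ → ℂ := fun t => h t * r t with hu
  have hu_smooth : ContDiff ℝ ∞ u := hh.mul hr
  have hu_supp : ∀ t ∉ Icc α β, u t = 0 := fun t ht => by simp [hu, hhs t ht]
  have hu_cs : HasCompactSupport u := by
    refine HasCompactSupport.intro (isCompact_Icc (a := α) (b := β)) fun t ht => hu_supp t ht
  have hu' : ∀ t, HasDerivAt u (ibpStep r h t) t := fun t =>
    ((hu_smooth.differentiable (by simp)) t).hasDerivAt
  have hv' : ∀ t, HasDerivAt (phaseExp ψ) (2 * Real.pi * Complex.I * Ψ₁ t * phaseExp ψ t) t :=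
    hasDerivAt_phaseExp hψ
  have hEc : Continuous (phaseExp ψ) := continuous_phaseExp hψ
  have hLu_cs : HasCompactSupport (ibpStep r h) := by
    have : ibpStep r h = deriv u := rfl
    rw [this]; exact hu_cs.deriv
  -- integrability of the three products
  have hi1 : Integrable (fun t => u t * (2 * Real.pi * Complex.I * Ψ₁ t * phaseExp ψ t)) :=
    (hu_smooth.continuous.mul ((continuous_const.mul (Complex.continuous_ofReal.comp hΨ)).mul hEc)).integrable_of_hasCompactSupport
      hu_cs.mul_right
  have hi2 : Integrable (fun t => ibpStep r h t * phaseExp ψ t) :=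
    ((contDiff_ibpStep hr hh).continuous.mul hEc).integrable_of_hasCompactSupport hLu_cs.mul_right
  have hi3 : Integrable (fun t => u t * phaseExp ψ t) :=
    (hu_smooth.continuous.mul hEc).integrable_of_hasCompactSupport hu_cs.mul_right
  have hibp := integral_mul_deriv_eq_deriv_mul_of_integrable (fun x _ => hu' x) (fun x _ => hv' x) hi1 hi2 hi3
  -- `u E' = 2πi h E`
  have hlhs : ∫ t, u t * (2 * Real.pi * Complex.I * Ψ₁ t * phaseExp ψ t) =
      (2 * Real.pi * Complex.I) * ∫ t, h t * phaseExp ψ t := by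
    rw [← integral_const_mul]
    refine integral_congr_ae (Eventually.of_forall fun t => ?_)
    simp only [hu]
    have := hrΨ t
    calc h t * r t * (2 * Real.pi * Complex.I * Ψ₁ t * phaseExp ψ t)
        = 2 * Real.pi * Complex.I * (r t * Ψ₁ t) * (h t * phaseExp ψ t) := by ring
      _ = 2 * Real.pi * Complex.I * (h t * phaseExp ψ t) := by rw [this, mul_one]
  rw [hlhs] at hibp
  have h2π : (2 * Real.pi * Complex.I : ℂ) ≠ 0 := by
    simp [Real.pi_ne_zero, Complex.I_ne_zero]
  calc ∫ t, h t * phaseExp ψ t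
      = (2 * Real.pi * Complex.I)⁻¹ * ((2 * Real.pi * Complex.I) * ∫ t, h t * phaseExp ψ t) := by
        rw [← mul_assoc, inv_mul_cancel₀ h2π, one_mul]
    _ = (2 * Real.pi * Complex.I)⁻¹ * -∫ t, ibpStep r h t * phaseExp ψ t := by rw [hibp]
    _ = _ := by ring

/-! ### Iteration -/

/-- The iterates `L_r^k h` are smooth. [folklore] -/
theorem contDiff_iterate_ibpStep {h r : ℝ → ℂ} (hh : ContDiff ℝ ∞ h) (hr : ContDiff ℝ ∞ r) (k : ℕ) :
    ContDiff ℝ ∞ ((ibpStep r)^[k] h) := by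
  induction k with
  | zero => exact hh
  | succ k ih => rw [Function.iterate_succ', Function.comp]; exact contDiff_ibpStep hr ih

/-- The iterates `L_r^k h` are smooth and vanish off `[α, β]` if `h` does. [folklore] -/
theorem iterate_ibpStep_props {h r : ℝ → ℂ} {α β : ℝ} (hh : ContDiff ℝ ∞ h)
    (hhs : ∀ t ∉ Icc α β, h t = 0) (hr : ContDiff ℝ ∞ r) (k : ℕ) :
    ContDiff ℝ ∞ ((ibpStep r)^[k] h) ∧ ∀ t ∉ Icc α β, (ibpStep r)^[k] h t = 0 := by
  induction k with
  | zero => exact ⟨hh, hhs⟩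
  | succ k ih =>
    rw [Function.iterate_succ', Function.comp]
    refine ⟨contDiff_ibpStep hr ih.1, fun t ht => ?_⟩
    have hopen : IsOpen (Icc α β)ᶜ := isClosed_Icc.isOpen_compl
    exact ibpStep_eq_zero_of_eqOn (r := r) hopen (fun s hs => ih.2 s hs) ht

/-- **`p` integrations by parts**: `∫ h E = (−(2πi)⁻¹)^p ∫ (L_r^p h) E`. [folklore] -/
theorem integral_mul_phaseExp_eq_iterate {h r : ℝ → ℂ} {ψ Ψ₁ : ℝ → ℝ} {α β : ℝ}
    (hh : ContDiff ℝ ∞ h) (hhs : ∀ t ∉ Icc α β, h t = 0) (hr : ContDiff ℝ ∞ r)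
    (hψ : ∀ t, HasDerivAt ψ (Ψ₁ t) t) (hΨ : Continuous Ψ₁) (hrΨ : ∀ t, r t * Ψ₁ t = 1) (p : ℕ) :
    ∫ t, h t * phaseExp ψ t =
      (-(2 * Real.pi * Complex.I)⁻¹) ^ p * ∫ t, (ibpStep r)^[p] h t * phaseExp ψ t := by
  induction p with
  | zero => simp
  | succ p ih =>
    obtain ⟨hk, hks⟩ := iterate_ibpStep_props hh hhs hr p
    rw [ih, integral_mul_phaseExp_eq_ibpStep hk hks hr hψ hΨ hrΨ, pow_succ, Function.iterate_succ',
      Function.comp]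
    ring

/-- **Jet bounds along the iteration**: with `‖h^{(j)}‖ ≤ A/L^j` (`j ≤ p`) and
`‖r^{(j)}‖ ≤ C_r/(λ L^j)` (`j ≤ p`), the `k`-th iterate satisfies
`‖(L_r^k h)^{(j)}‖ ≤ A (2^p C_r/(λL))^k / L^j` for `j ≤ p − k`. [folklore] -/
theorem norm_iteratedDeriv_iterate_ibpStep_le {h r : ℝ → ℂ} (hh : ContDiff ℝ ∞ h)
    (hr : ContDiff ℝ ∞ r) {p : ℕ} {A Cr lam L : ℝ} (hA : 0 ≤ A) (hCr : 0 ≤ Cr) (hlam : 0 < lam)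
    (hL : 0 < L) (hhA : ∀ j ≤ p, ∀ t, ‖iteratedDeriv j h t‖ ≤ A / L ^ j)
    (hrC : ∀ j ≤ p, ∀ t, ‖iteratedDeriv j r t‖ ≤ Cr / (lam * L ^ j)) :
    ∀ k ≤ p, ∀ j ≤ p - k, ∀ t,
      ‖iteratedDeriv j ((ibpStep r)^[k] h) t‖ ≤ A * (2 ^ p * Cr / (lam * L)) ^ k / L ^ j := by
  intro k
  induction k with
  | zero =>
    intro _ j hj t
    simpa using hhA j (by omega) t
  | succ k ih =>
    intro hk j hj t
    have hk' : k ≤ p := (Nat.le_succ k).trans hk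
    have hsmooth : ContDiff ℝ ∞ ((ibpStep r)^[k] h) := contDiff_iterate_ibpStep hh hr k
    rw [Function.iterate_succ', Function.comp_apply, ibpStep, ← iteratedDeriv_succ']
    -- Leibniz on `(L^k h) r` at order `j + 1 ≤ p − k`
    have hj1 : j + 1 ≤ p - k := by omega
    set Ak : ℝ := A * (2 ^ p * Cr / (lam * L)) ^ k with hAk
    have hAk0 : 0 ≤ Ak := by positivity
    have hmul := norm_iteratedDeriv_mul_le_of_scaled hsmooth hr t (j + 1) (A := Ak) (B := Cr / lam) hAk0
      hL (fun i hi => ih hk' i (hi.trans hj1) t) (fun i hi => by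
        rw [div_div]; exact hrC i (by omega) t)
    refine hmul.trans ?_
    have h2 : (2 : ℝ) ^ (j + 1) ≤ 2 ^ p := pow_le_pow_right₀ (by norm_num) (by omega)
    have hlam0 : lam ≠ 0 := hlam.ne'
    have hL0 : L ≠ 0 := hL.ne'
    have key : A * (2 ^ p * Cr / (lam * L)) ^ (k + 1) / L ^ j = 2 ^ p * Ak * (Cr / lam) / L ^ (j + 1) := by
      rw [hAk, pow_succ, pow_succ]; field_simp
    rw [key]
    have h0 : 0 ≤ Ak * (Cr / lam) / L ^ (j + 1) := by positivity
    calc 2 ^ (j + 1) * Ak * (Cr / lam) / L ^ (j + 1) = 2 ^ (j + 1) * (Ak * (Cr / lam) / L ^ (j + 1)) := by ring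
      _ ≤ 2 ^ p * (Ak * (Cr / lam) / L ^ (j + 1)) := mul_le_mul_of_nonneg_right h2 h0
      _ = 2 ^ p * Ak * (Cr / lam) / L ^ (j + 1) := by ring

/-- **Iterated non-stationary phase.**  Let `h : ℝ → ℂ` be smooth and vanish off `[α, β]`
(`α ≤ β`), `ψ` a real phase with continuous derivative `Ψ₁`, `r : ℝ → ℂ` smooth with `r Ψ₁ = 1`
(so `Ψ₁` does not vanish), and suppose `‖h^{(j)}‖ ≤ A/L^j` and `‖r^{(j)}‖ ≤ C_r/(λ L^j)` for
`j ≤ p`.  Then `‖∫ h(t) e^{2πiψ(t)} dt‖ ≤ (β − α) A (2^p C_r/(2π λ L))^p`. [folklore] -/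
theorem norm_integral_mul_phaseExp_le {h r : ℝ → ℂ} {ψ Ψ₁ : ℝ → ℝ} {α β : ℝ} (hαβ : α ≤ β)
    (hh : ContDiff ℝ ∞ h) (hhs : ∀ t ∉ Icc α β, h t = 0) (hr : ContDiff ℝ ∞ r)
    (hψ : ∀ t, HasDerivAt ψ (Ψ₁ t) t) (hΨ : Continuous Ψ₁) (hrΨ : ∀ t, r t * Ψ₁ t = 1)
    {p : ℕ} {A Cr lam L : ℝ} (hA : 0 ≤ A) (hCr : 0 ≤ Cr) (hlam : 0 < lam) (hL : 0 < L)
    (hhA : ∀ j ≤ p, ∀ t, ‖iteratedDeriv j h t‖ ≤ A / L ^ j)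
    (hrC : ∀ j ≤ p, ∀ t, ‖iteratedDeriv j r t‖ ≤ Cr / (lam * L ^ j)) :
    ‖∫ t, h t * phaseExp ψ t‖ ≤ (β - α) * A * (2 ^ p * Cr / (2 * Real.pi * lam * L)) ^ p := by
  rw [integral_mul_phaseExp_eq_iterate hh hhs hr hψ hΨ hrΨ p, norm_mul, norm_pow, norm_neg, norm_inv]
  have hnorm : ‖(2 * Real.pi * Complex.I : ℂ)‖ = 2 * Real.pi := by
    rw [norm_mul, Complex.norm_I, mul_one, norm_mul, Complex.norm_ofNat, Complex.norm_real,
      Real.norm_of_nonneg Real.pi_pos.le]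
  rw [hnorm]
  obtain ⟨hk, hks⟩ := iterate_ibpStep_props hh hhs hr p
  -- sup bound of the last iterate
  have hsup : ∀ t, ‖(ibpStep r)^[p] h t‖ ≤ A * (2 ^ p * Cr / (lam * L)) ^ p := by
    intro t
    have := norm_iteratedDeriv_iterate_ibpStep_le hh hr hA hCr hlam hL hhA hrC p le_rfl 0 (by omega) t
    simpa using this
  -- the integral over `[α, β]`
  have hint_eq : ∫ t, (ibpStep r)^[p] h t * phaseExp ψ t = ∫ t in Icc α β, (ibpStep r)^[p] h t * phaseExp ψ t := by
    rw [← integral_indicator measurableSet_Icc]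
    refine integral_congr_ae (Eventually.of_forall fun t => ?_)
    show (ibpStep r)^[p] h t * phaseExp ψ t = (Icc α β).indicator (fun t => (ibpStep r)^[p] h t * phaseExp ψ t) t
    by_cases ht : t ∈ Icc α β
    · rw [indicator_of_mem ht]
    · rw [indicator_of_notMem ht, hks t ht, zero_mul]
  rw [hint_eq]
  have hbound : ‖∫ t in Icc α β, (ibpStep r)^[p] h t * phaseExp ψ t‖ ≤ (β - α) * (A * (2 ^ p * Cr / (lam * L)) ^ p) := by
    have h1 : ‖∫ t in Icc α β, (ibpStep r)^[p] h t * phaseExp ψ t‖ ≤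
        (A * (2 ^ p * Cr / (lam * L)) ^ p) * (volume (Icc α β)).toReal := by
      refine norm_setIntegral_le_of_norm_le_const (by rw [Real.volume_Icc]; exact ENNReal.ofReal_lt_top) ?_
      intro t _
      rw [norm_mul, norm_phaseExp, mul_one]
      exact hsup t
    rw [Real.volume_Icc, ENNReal.toReal_ofReal (by linarith)] at h1
    linarith
  have h2π : 0 < 2 * Real.pi := by positivity
  calc (2 * Real.pi)⁻¹ ^ p * ‖∫ t in Icc α β, (ibpStep r)^[p] h t * phaseExp ψ t‖
      ≤ (2 * Real.pi)⁻¹ ^ p * ((β - α) * (A * (2 ^ p * Cr / (lam * L)) ^ p)) :=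
        mul_le_mul_of_nonneg_left hbound (by positivity)
    _ = (β - α) * A * (2 ^ p * Cr / (2 * Real.pi * lam * L)) ^ p := by
        rw [show 2 ^ p * Cr / (2 * Real.pi * lam * L) = (2 * Real.pi)⁻¹ * (2 ^ p * Cr / (lam * L)) by
          field_simp, mul_pow]
        ring

end Literature.Analysis.Asymptotics
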